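import Literature.NumberTheory.EllipticCurves.NeronModelExistence
import Literature.AlgebraicGeometry.Motives.AbelianVariety
import Mathlib.CategoryTheory.Monoidal.Cartesian.Grp
import HarnessLib

/-!
# Sections of group schemes over a ring: the Néron bijection `𝒩(R) ≃ E(K)` is a group
# isomorphism, and specialization of sections to a residue field is a group homomorphism

Proof-only companion (no definitions, no named facts, Mathlib + landed tree vocabulary only) to
`Literature.NumberTheory.EllipticCurves.NeronModelExistence` (`IsNeronModel.sectionsEquiv`: Liu,
*Algebraic Geometry and Arithmetic Curves*, §10.2.2, p. 499, "the canonical map `𝒩(S) → E(K)` is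
bijective"; Bosch–Lütkebohmert–Raynaud, *Néron Models*, 1.2) and to
`Literature.AlgebraicGeometry.Motives.AlgPoints` (`K`-points `Spec K ⟶ X` of a `K`-scheme).

## Contents

* `IsNeronModel.sectionsEquiv_mul` (with `_one`, `_pow`, `_symm_mul`, `_symm_one`, `_symm_pow`):
  for a Néron model `𝒩 / R` of a group scheme `E / K`, the bijection
  `IsNeronModel.sectionsEquiv : (Spec R ⟶ 𝒩) ≃ (Spec K ⟶ E)` is MULTIPLICATIVE for Mathlib's group
  structures `Hom.group` on morphisms into a group object — the generic-fibre functor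
  `Over.pullback (Spec K → Spec R)` is (cartesian) monoidal (`Functor.map_mul`), composition is
  multiplicative (`MonObj.comp_mul`, `MonObj.mul_comp` for the chosen group isomorphism
  `𝒩_K ≅ E`).  Hence a divisible `K`-point of `E` is the generic fibre of a divisible section
  (`IsNeronModel.exists_section_of_forall_exists_pow_eq`).
* `specialization_mul`, `specialization_left_comp_fst`: for ANY group scheme `𝒜 → Spec R` and any
  `R`-algebra `κ` that is a field, the specialization `s ↦ s_κ` of sections
  `s : Spec R ⟶ 𝒜` to `κ`-points of the fibre `𝒜_κ := 𝒜 ×_R κ`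
  (`toUnit (Spec κ) ≫ ε ≫ (Over.pullback (Spec κ → Spec R)).map s`, an element of
  `AlgPoints 𝒜_κ κ`) is multiplicative and lies over `Spec κ → Spec R → 𝒜`.  Consequently
  (`pullback_map_eq_of_forall_exists_pow_eq`, `specialization_comp_left_eq_of_forall_exists_pow_eq`):
  **if `𝒜_κ(κ)` has no non-trivial divisible element, a divisible section `s` agrees with the
  unit section after base change to `κ`** — in the two shapes
  `(Over.pullback ι).map s = (Over.pullback ι).map 1` and `ι ≫ s.left = ι ≫ (1 : Spec R ⟶ 𝒜).left`,
  `ι = Spec.map (CommRingCat.ofHom (algebraMap R κ))`, which are the hypotheses of the rigidity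
  theorems of `Literature.AlgebraicGeometry.Morphisms.SeparatedRigidityDedekind`
  (`Over.tensorUnit_hom_ext_of_forall_maximal_pullback` / `…_quotient`, two sections of a
  separated `R`-scheme over a Dedekind domain agreeing at infinitely many closed points are equal).
* `exists_eq_toUnit_comp`, `forall_exists_pow_eq_of_toUnit_comp`, `toUnit_comp_eq_one`: passage
  between `K`-points in the sense of `AlgPoints` (source `specOver K K`, structure map
  `Spec (algebraMap K K)`) and morphisms from the monoidal unit `𝟙_ (Over (Spec K))` (structure map
  `𝟙 (Spec K)`); `isIso_toUnit_specOver`.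

## Why (route memo `HOME/staging/f/f-083/g2/F0369-FG-ROUTE.md`, junction J-c)

In the closed-point induction for FACT-LIST row F-0369 ([AbsTopIII] Rmk. 1.5.4 (i) p. 33: "by
restricting to various closed points of this variety, one reduces to the case where `k` itself is
an MLF"), a divisible point `x ∈ A(L)` of an abelian variety over the fraction field `L` of a
Dedekind domain `R'` extends (Néron mapping property of the proper smooth model furnished by
`exists_abelianScheme_away_holds` and `isNeronModel_of_isProper_of_smooth`) to a section `s_x` of
`𝒜 → Spec R'`; this file supplies steps 3–4 of the memo: `x ↦ s_x` and `s ↦ s_𝔪` are group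
homomorphisms, so `s_x` is divisible and its specializations are trivial wherever the special fibre
has no divisible points (over `p`-adic residue fields:
`AlgPoints.eq_one_of_forall_exists_pow_eq_of_finite_padic`).  Classical; nothing here bears on
[IUTchIII] Cor. 3.12; typed ≠ discharged.

## References

* Q. Liu, *Algebraic Geometry and Arithmetic Curves*, OUP 2002, §10.2.2 (p. 499: the reduction map
  `E(K) = 𝒩(S) → 𝒩_s(k(s))`). [Liu2002]
* S. Bosch, W. Lütkebohmert, M. Raynaud, *Néron Models*, Springer 1990, §1.2. [BLRNeronModels1990]
* S. Mochizuki, *Topics in Absolute Anabelian Geometry III*, Rmk. 1.5.4 (i) p. 33.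
  [MochizukiAbsTopIII2015]
-/

noncomputable section

universe u

open CategoryTheory CategoryTheory.Limits MonoidalCategory CartesianMonoidalCategory
open scoped MonObj CategoryTheory.Obj

namespace Literature.NumberTheory.EllipticCurves

open _root_.AlgebraicGeometry
open Literature.AlgebraicGeometry.Motives (SchemeOver specOver AlgPoints)

/-! ### The Néron bijection `𝒩(R) ≃ E(K)` is multiplicative -/

section SectionsMul

variable {R : Type u} [CommRing R] {K : Type u} [Field K] [Algebra R K]
variable {𝒩 : Over (Spec (.of R))} [GrpObj 𝒩] {E : Over (Spec (.of K))} [GrpObj E]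

/-- The Néron bijection unfolded: `sectionsEquiv s = ε ≫ s_K ≫ e` with `ε : Spec K ≅ (Spec R)_K` the unit
isomorphism of the monoidal generic-fibre functor and `e : 𝒩_K ≅ E` the chosen group isomorphism
(Liu, §10.2.2, p. 499). [cite: Liu2002, §10.2.2 (p. 499)] -/
theorem IsNeronModel.sectionsEquiv_apply (h : IsNeronModel R K 𝒩 E)
    (s : 𝟙_ (Over (Spec (.of R))) ⟶ 𝒩) :
    h.sectionsEquiv s = (Functor.Monoidal.εIso (genericFibre R K)).hom ≫
      (genericFibre R K).map s ≫ h.exists_iso.choose.hom := by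
  simp [IsNeronModel.sectionsEquiv, Iso.homCongr_apply]

/-- **The Néron bijection `𝒩(R) ≃ E(K)` is multiplicative** for the group structures on sections of the
group scheme `𝒩` and on `K`-points of the group scheme `E` (Mathlib's `Hom.group`): the generic-fibre
functor is monoidal (`Functor.map_mul`), precomposition is multiplicative (`MonObj.comp_mul`) and so is
postcomposition with the group isomorphism `𝒩_K ≅ E` (`MonObj.mul_comp`).  (Liu, §10.2.2, p. 499:
`E(K) = 𝒩(S)` as groups; BLR 1.2.) [cite: Liu2002, §10.2.2 (p. 499)] -/
theorem IsNeronModel.sectionsEquiv_mul (h : IsNeronModel R K 𝒩 E)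
    (s t : 𝟙_ (Over (Spec (.of R))) ⟶ 𝒩) :
    h.sectionsEquiv (s * t) = h.sectionsEquiv s * h.sectionsEquiv t := by
  haveI : IsMonHom h.exists_iso.choose.hom := h.exists_iso.choose_spec
  rw [sectionsEquiv_apply, sectionsEquiv_apply, sectionsEquiv_apply, Functor.map_mul,
    MonObj.mul_comp, MonObj.comp_mul]

/-- The Néron bijection sends the unit section to the unit point. [cite: Liu2002, §10.2.2 (p. 499)] -/
theorem IsNeronModel.sectionsEquiv_one (h : IsNeronModel R K 𝒩 E) :
    h.sectionsEquiv (1 : 𝟙_ (Over (Spec (.of R))) ⟶ 𝒩) = 1 :=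
  (MonoidHom.mk' (fun s => h.sectionsEquiv s) h.sectionsEquiv_mul).map_one

/-- The Néron bijection commutes with powers. [cite: Liu2002, §10.2.2 (p. 499)] -/
theorem IsNeronModel.sectionsEquiv_pow (h : IsNeronModel R K 𝒩 E)
    (s : 𝟙_ (Over (Spec (.of R))) ⟶ 𝒩) (n : ℕ) :
    h.sectionsEquiv (s ^ n) = h.sectionsEquiv s ^ n :=
  (MonoidHom.mk' (fun s => h.sectionsEquiv s) h.sectionsEquiv_mul).map_pow s n

/-- The inverse Néron bijection `E(K) → 𝒩(R)` (Néron extension of points) is multiplicative.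
[cite: Liu2002, §10.2.2 (p. 499)] -/
theorem IsNeronModel.sectionsEquiv_symm_mul (h : IsNeronModel R K 𝒩 E)
    (x y : 𝟙_ (Over (Spec (.of K))) ⟶ E) :
    h.sectionsEquiv.symm (x * y) = h.sectionsEquiv.symm x * h.sectionsEquiv.symm y :=
  map_mul (MulEquiv.mk' h.sectionsEquiv h.sectionsEquiv_mul).symm x y

/-- The Néron extension of the unit point is the unit section. [cite: Liu2002, §10.2.2 (p. 499)] -/
theorem IsNeronModel.sectionsEquiv_symm_one (h : IsNeronModel R K 𝒩 E) :
    h.sectionsEquiv.symm (1 : 𝟙_ (Over (Spec (.of K))) ⟶ E) = 1 :=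
  map_one (MulEquiv.mk' h.sectionsEquiv h.sectionsEquiv_mul).symm

/-- The Néron extension of points commutes with powers. [cite: Liu2002, §10.2.2 (p. 499)] -/
theorem IsNeronModel.sectionsEquiv_symm_pow (h : IsNeronModel R K 𝒩 E)
    (x : 𝟙_ (Over (Spec (.of K))) ⟶ E) (n : ℕ) :
    h.sectionsEquiv.symm (x ^ n) = h.sectionsEquiv.symm x ^ n :=
  map_pow (MulEquiv.mk' h.sectionsEquiv h.sectionsEquiv_mul).symm x n

/-- A point admitting `n`-th roots for all `n ≥ 1` extends to a section admitting `n`-th roots for all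
`n ≥ 1` (roots extend by the Néron property and the extension is multiplicative).
[cite: Liu2002, §10.2.2 (p. 499)] -/
theorem IsNeronModel.forall_exists_pow_eq_sectionsEquiv_symm (h : IsNeronModel R K 𝒩 E)
    (x : 𝟙_ (Over (Spec (.of K))) ⟶ E)
    (hx : ∀ n : ℕ, 0 < n → ∃ y : 𝟙_ (Over (Spec (.of K))) ⟶ E, y ^ n = x) :
    ∀ n : ℕ, 0 < n → ∃ t : 𝟙_ (Over (Spec (.of R))) ⟶ 𝒩, t ^ n = h.sectionsEquiv.symm x := by
  intro n hn
  obtain ⟨y, hy⟩ := hx n hn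
  exact ⟨h.sectionsEquiv.symm y, by rw [← sectionsEquiv_symm_pow, hy]⟩

end SectionsMul

/-! ### Specialization of sections to a residue field -/

section Specialization

variable {R : Type u} [CommRing R] (𝒜 : Over (Spec (.of R))) [GrpObj 𝒜]
  (κ : Type u) [Field κ] [Algebra R κ]

/-- The morphism `toUnit : specOver κ κ ⟶ 𝟙_ (Over (Spec κ))` from `Spec κ` with structure map
`Spec (algebraMap κ κ)` to `Spec κ` with structure map `𝟙` is an isomorphism (both are `Spec κ`;
`algebraMap κ κ = id`; `κ`-points as `κ`-morphisms `Spec κ → X`, Hartshorne II Ex. 2.7).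
[cite: Hartshorne1977, II Ex. 2.7] -/
theorem isIso_toUnit_specOver : IsIso (toUnit (specOver κ κ)) := by
  let i : specOver κ κ ≅ 𝟙_ (Over (Spec (.of κ))) := Over.isoMk (Iso.refl _) (by
    simp only [Over.mk_hom, Algebra.algebraMap_self, CommRingCat.ofHom_id, Spec.map_id]
    rfl)
  rw [toUnit_unique (toUnit (specOver κ κ)) i.hom]
  infer_instance

/-- **Specialization of sections is multiplicative.**  For a group scheme `𝒜 → Spec R` and an
`R`-algebra `κ` (a field), the specialization `s ↦ s_κ := toUnit ≫ ε ≫ (Over.pullback ι).map s`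
(`ι : Spec κ → Spec R`) from sections `Spec R ⟶ 𝒜` to `κ`-points of the fibre `𝒜_κ = 𝒜 ×_R κ`
(with the base-changed group structure `Functor.grpObjObj`) satisfies `(s t)_κ = s_κ t_κ`: base change
is a monoidal functor (`Functor.map_mul`) and precomposition is multiplicative (`MonObj.comp_mul`).
(Liu, §10.2.2, p. 499, the reduction map `𝒩(S) → 𝒩_s(k(s))` is a group homomorphism.)
[cite: Liu2002, §10.2.2 (p. 499)] -/
theorem specialization_mul (s t : 𝟙_ (Over (Spec (.of R))) ⟶ 𝒜) :
    toUnit (specOver κ κ) ≫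
        (Functor.Monoidal.εIso (Over.pullback (Spec.map (CommRingCat.ofHom (algebraMap R κ))))).hom ≫
        (Over.pullback (Spec.map (CommRingCat.ofHom (algebraMap R κ)))).map (s * t) =
      (toUnit (specOver κ κ) ≫
        (Functor.Monoidal.εIso (Over.pullback (Spec.map (CommRingCat.ofHom (algebraMap R κ))))).hom ≫
        (Over.pullback (Spec.map (CommRingCat.ofHom (algebraMap R κ)))).map s) *
      (toUnit (specOver κ κ) ≫
        (Functor.Monoidal.εIso (Over.pullback (Spec.map (CommRingCat.ofHom (algebraMap R κ))))).hom ≫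
        (Over.pullback (Spec.map (CommRingCat.ofHom (algebraMap R κ)))).map t) := by
  rw [Functor.map_mul, MonObj.comp_mul, MonObj.comp_mul]

omit [GrpObj 𝒜] in
/-- The specialization `s_κ : Spec κ ⟶ 𝒜 ×_R κ` of a section `s` lies over `Spec κ → Spec R → 𝒜`:
`s_κ ≫ pr₁ = ι ≫ s` (the reduction map of Liu, §10.2.2, p. 499, computed through the universal
property of the fibre product, Hartshorne II Thm. 3.3). [cite: Liu2002, §10.2.2 (p. 499)] -/
theorem specialization_left_comp_fst (s : 𝟙_ (Over (Spec (.of R))) ⟶ 𝒜) :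
    (toUnit (specOver κ κ) ≫
        (Functor.Monoidal.εIso (Over.pullback (Spec.map (CommRingCat.ofHom (algebraMap R κ))))).hom ≫
        (Over.pullback (Spec.map (CommRingCat.ofHom (algebraMap R κ)))).map s).left ≫
      pullback.fst 𝒜.hom (Spec.map (CommRingCat.ofHom (algebraMap R κ))) =
    Spec.map (CommRingCat.ofHom (algebraMap R κ)) ≫ s.left := by
  simp only [Over.comp_left, Category.assoc, Over.pullback_map_left,
    Over.toUnit_left, Over.mk_hom, Functor.Monoidal.εIso_hom, Over.ε_pullback_left]
  erw [pullback.lift_fst]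
  have e1 : Spec.map (CommRingCat.ofHom (algebraMap κ κ)) = 𝟙 _ := by
    rw [Algebra.algebraMap_self, CommRingCat.ofHom_id, Spec.map_id]
  have e3 : inv (pullback.snd (𝟙 (Spec (.of R))) (Spec.map (CommRingCat.ofHom (algebraMap R κ)))) ≫
      pullback.fst (𝟙 (Spec (.of R))) (Spec.map (CommRingCat.ofHom (algebraMap R κ))) =
        Spec.map (CommRingCat.ofHom (algebraMap R κ)) := by
    rw [IsIso.inv_comp_eq]
    exact (Category.comp_id _).symm.trans pullback.condition
  change Spec.map (CommRingCat.ofHom (algebraMap κ κ)) ≫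
      inv (pullback.snd (𝟙 (Spec (.of R))) (Spec.map (CommRingCat.ofHom (algebraMap R κ)))) ≫
        pullback.fst (𝟙 (Spec (.of R))) (Spec.map (CommRingCat.ofHom (algebraMap R κ))) ≫ s.left =
      Spec.map (CommRingCat.ofHom (algebraMap R κ)) ≫ s.left
  rw [e1, Category.id_comp, ← Category.assoc, e3]


omit [GrpObj 𝒜] in
/-- Sections with equal specializations `s_κ = t_κ` have equal base changes `s ×_R κ = t ×_R κ`
(`toUnit` and `ε` are isomorphisms; Liu, §10.2.2, p. 499). [cite: Liu2002, §10.2.2 (p. 499)] -/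
theorem pullback_map_eq_of_specialization_eq (s t : 𝟙_ (Over (Spec (.of R))) ⟶ 𝒜)
    (h : toUnit (specOver κ κ) ≫
        (Functor.Monoidal.εIso (Over.pullback (Spec.map (CommRingCat.ofHom (algebraMap R κ))))).hom ≫
        (Over.pullback (Spec.map (CommRingCat.ofHom (algebraMap R κ)))).map s =
      toUnit (specOver κ κ) ≫
        (Functor.Monoidal.εIso (Over.pullback (Spec.map (CommRingCat.ofHom (algebraMap R κ))))).hom ≫
        (Over.pullback (Spec.map (CommRingCat.ofHom (algebraMap R κ)))).map t) :
    (Over.pullback (Spec.map (CommRingCat.ofHom (algebraMap R κ)))).map s =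
      (Over.pullback (Spec.map (CommRingCat.ofHom (algebraMap R κ)))).map t := by
  haveI := isIso_toUnit_specOver κ
  simpa only [cancel_epi] using h

/-- **A divisible section specializes to the unit wherever the fibre has no divisible points** (raw
form `s_κ = 1_κ`): if every element of `𝒜_κ(κ)` admitting `n`-th roots for all `n ≥ 1` is trivial and
the section `s : Spec R ⟶ 𝒜` admits `n`-th roots for all `n ≥ 1`, then `s_κ = 1_κ` — specialization
is a group homomorphism (`specialization_mul`).  ([AbsTopIII] Rmk. 1.5.4 (i) p. 33, "by restricting to
various closed points"; Liu, §10.2.2, p. 499.) [cite: MochizukiAbsTopIII2015, Rmk 1.5.4 (i) p.33] -/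
theorem specialization_eq_of_forall_exists_pow_eq
    (Hκ : ∀ x : AlgPoints ((Over.pullback (Spec.map (CommRingCat.ofHom (algebraMap R κ)))).obj 𝒜) κ,
      (∀ n : ℕ, 0 < n → ∃ y, y ^ n = x) → x = 1)
    (s : 𝟙_ (Over (Spec (.of R))) ⟶ 𝒜)
    (hs : ∀ n : ℕ, 0 < n → ∃ t : 𝟙_ (Over (Spec (.of R))) ⟶ 𝒜, t ^ n = s) :
    toUnit (specOver κ κ) ≫
        (Functor.Monoidal.εIso (Over.pullback (Spec.map (CommRingCat.ofHom (algebraMap R κ))))).hom ≫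
        (Over.pullback (Spec.map (CommRingCat.ofHom (algebraMap R κ)))).map s =
      toUnit (specOver κ κ) ≫
        (Functor.Monoidal.εIso (Over.pullback (Spec.map (CommRingCat.ofHom (algebraMap R κ))))).hom ≫
        (Over.pullback (Spec.map (CommRingCat.ofHom (algebraMap R κ)))).map 1 := by
  let φ : (𝟙_ (Over (Spec (.of R))) ⟶ 𝒜) →*
      AlgPoints ((Over.pullback (Spec.map (CommRingCat.ofHom (algebraMap R κ)))).obj 𝒜) κ :=
    MonoidHom.mk' (fun s => toUnit (specOver κ κ) ≫
        (Functor.Monoidal.εIso (Over.pullback (Spec.map (CommRingCat.ofHom (algebraMap R κ))))).hom ≫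
        (Over.pullback (Spec.map (CommRingCat.ofHom (algebraMap R κ)))).map s)
      (specialization_mul 𝒜 κ)
  have hφ : φ s = 1 := Hκ (φ s) fun n hn => by
    obtain ⟨t, ht⟩ := hs n hn
    exact ⟨φ t, by rw [← map_pow, ht]⟩
  have hφ' : φ s = φ 1 := by rw [hφ, map_one]
  exact hφ'

/-- **A divisible section agrees with the unit section after base change to `κ` wherever the fibre has
no divisible points** (base-change form `s ×_R κ = 1 ×_R κ`, the hypothesis shape of
`Over.tensorUnit_hom_ext_of_forall_maximal_pullback` of `Morphisms/SeparatedRigidityDedekind`).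
[cite: MochizukiAbsTopIII2015, Rmk 1.5.4 (i) p.33] -/
theorem pullback_map_eq_of_forall_exists_pow_eq
    (Hκ : ∀ x : AlgPoints ((Over.pullback (Spec.map (CommRingCat.ofHom (algebraMap R κ)))).obj 𝒜) κ,
      (∀ n : ℕ, 0 < n → ∃ y, y ^ n = x) → x = 1)
    (s : 𝟙_ (Over (Spec (.of R))) ⟶ 𝒜)
    (hs : ∀ n : ℕ, 0 < n → ∃ t : 𝟙_ (Over (Spec (.of R))) ⟶ 𝒜, t ^ n = s) :
    (Over.pullback (Spec.map (CommRingCat.ofHom (algebraMap R κ)))).map s =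
      (Over.pullback (Spec.map (CommRingCat.ofHom (algebraMap R κ)))).map 1 :=
  pullback_map_eq_of_specialization_eq 𝒜 κ s 1
    (specialization_eq_of_forall_exists_pow_eq 𝒜 κ Hκ s hs)

/-- **A divisible section agrees with the unit section at the closed point `Spec κ → Spec R`
wherever the fibre has no divisible points** (composition form `ι ≫ s = ι ≫ 1`, the hypothesis shape
of `Over.tensorUnit_hom_ext_of_infinite_quotient` of `Morphisms/SeparatedRigidityDedekind`; for
`κ = R ⧸ 𝔪`, `algebraMap R (R ⧸ 𝔪) = Ideal.Quotient.mk 𝔪`). [cite: MochizukiAbsTopIII2015, Rmk 1.5.4 (i) p.33] -/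
theorem specialization_comp_left_eq_of_forall_exists_pow_eq
    (Hκ : ∀ x : AlgPoints ((Over.pullback (Spec.map (CommRingCat.ofHom (algebraMap R κ)))).obj 𝒜) κ,
      (∀ n : ℕ, 0 < n → ∃ y, y ^ n = x) → x = 1)
    (s : 𝟙_ (Over (Spec (.of R))) ⟶ 𝒜)
    (hs : ∀ n : ℕ, 0 < n → ∃ t : 𝟙_ (Over (Spec (.of R))) ⟶ 𝒜, t ^ n = s) :
    Spec.map (CommRingCat.ofHom (algebraMap R κ)) ≫ s.left =
      Spec.map (CommRingCat.ofHom (algebraMap R κ)) ≫ (1 : 𝟙_ (Over (Spec (.of R))) ⟶ 𝒜).left := by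
  rw [← specialization_left_comp_fst 𝒜 κ s, ← specialization_left_comp_fst 𝒜 κ 1,
    specialization_eq_of_forall_exists_pow_eq 𝒜 κ Hκ s hs]

/-- The unit of the group of sections is the unit section: `(1 : Spec R ⟶ 𝒜) = η[𝒜]` in `Over (Spec R)`
(`Hom.one_def` with `toUnit (𝟙_) = 𝟙`; the group `𝒜(S)` of `S`-valued points of a group scheme,
Görtz–Wedhorn I, Section (4.7) / Liu §10.2.2). [cite: Liu2002, §10.2.2 (p. 499)] -/
theorem one_eq_unit_of_tensorUnit : (1 : 𝟙_ (Over (Spec (.of R))) ⟶ 𝒜) = η[𝒜] := by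
  rw [Hom.one_def, toUnit_unique (toUnit _) (𝟙 _), Category.id_comp]

omit [GrpObj 𝒜] in
/-- A morphism `s : 𝟙_ (Over (Spec R)) ⟶ 𝒜` is a section of the structure morphism:
`s ≫ (𝒜 → Spec R) = 𝟙` (`R`-valued points are sections, Liu §10.2.2, p. 499).
[cite: Liu2002, §10.2.2 (p. 499)] -/
theorem left_comp_hom_of_tensorUnit (s : 𝟙_ (Over (Spec (.of R))) ⟶ 𝒜) :
    s.left ≫ 𝒜.hom = 𝟙 _ :=
  Over.w s

omit [GrpObj 𝒜] in
/-- The fibre `𝒜 ×_R κ → Spec κ` of a proper `R`-scheme is proper (proper morphisms are stable under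
base change, Hartshorne II Cor. 4.8 (c)). [cite: Hartshorne1977, II Cor. 4.8 (c)] -/
theorem isProper_pullback_obj_hom_of_isProper [IsProper 𝒜.hom] :
    IsProper ((Over.pullback (Spec.map (CommRingCat.ofHom (algebraMap R κ)))).obj 𝒜).hom := by
  change IsProper (pullback.snd 𝒜.hom (Spec.map (CommRingCat.ofHom (algebraMap R κ))))
  infer_instance

end Specialization

/-! ### Points `Spec K ⟶ E` versus morphisms from the unit object -/

section Points

variable {K : Type u} [Field K] (X : Over (Spec (.of K))) [GrpObj X]

omit [GrpObj X] in
/-- Every `K`-point `x : specOver K K ⟶ X` is `toUnit ≫ x'` for a (unique) morphism `x'` from the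
monoidal unit `𝟙_ (Over (Spec K))` (`toUnit` is an isomorphism; `K`-rational points as `K`-morphisms
`Spec K → X`, Hartshorne II Ex. 2.7). [cite: Hartshorne1977, II Ex. 2.7] -/
theorem exists_eq_toUnit_comp (x : specOver K K ⟶ X) :
    ∃ x' : 𝟙_ (Over (Spec (.of K))) ⟶ X, toUnit (specOver K K) ≫ x' = x := by
  haveI := isIso_toUnit_specOver K
  exact ⟨inv (toUnit (specOver K K)) ≫ x, by simp⟩

/-- If the `K`-point `toUnit ≫ x'` admits `n`-th roots for all `n ≥ 1` in `X(K)`, so does `x'` among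
morphisms `𝟙_ ⟶ X` (precomposition with the isomorphism `toUnit` is multiplicative, `MonObj.comp_pow`;
Hartshorne II Ex. 2.7). [cite: Hartshorne1977, II Ex. 2.7] -/
theorem forall_exists_pow_eq_of_toUnit_comp (x' : 𝟙_ (Over (Spec (.of K))) ⟶ X)
    (hx : ∀ n : ℕ, 0 < n → ∃ y : specOver K K ⟶ X, y ^ n = toUnit (specOver K K) ≫ x') :
    ∀ n : ℕ, 0 < n → ∃ y' : 𝟙_ (Over (Spec (.of K))) ⟶ X, y' ^ n = x' := by
  haveI := isIso_toUnit_specOver K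
  intro n hn
  obtain ⟨y, hy⟩ := hx n hn
  refine ⟨inv (toUnit (specOver K K)) ≫ y, ?_⟩
  rw [← cancel_epi (toUnit (specOver K K)), MonObj.comp_pow, IsIso.hom_inv_id_assoc, hy]

/-- If `x' = 1` then the `K`-point `toUnit ≫ x'` is the unit of `X(K)` (`MonObj.comp_one`; Hartshorne
II Ex. 2.7). [cite: Hartshorne1977, II Ex. 2.7] -/
theorem toUnit_comp_eq_one {x' : 𝟙_ (Over (Spec (.of K))) ⟶ X} (h : x' = 1) :
    toUnit (specOver K K) ≫ x' = 1 := by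
  rw [h, MonObj.comp_one]

end Points

/-! ### The package for Néron models -/

section Neron

variable {R : Type u} [CommRing R] {K : Type u} [Field K] [Algebra R K]
variable {𝒩 : Over (Spec (.of R))} [GrpObj 𝒩] {E : Over (Spec (.of K))} [GrpObj E]

/-- **A divisible `K`-point of `E` is the generic fibre of a divisible section of a Néron model**
(junction J-c (i) of the F-0369 route memo): for `h : IsNeronModel R K 𝒩 E` and `x ∈ E(K)`
(`x : specOver K K ⟶ E`) admitting `n`-th roots for all `n ≥ 1`, there is a section `s : Spec R ⟶ 𝒩`
with `toUnit ≫ h.sectionsEquiv s = x` admitting `n`-th roots for all `n ≥ 1` (Néron mapping property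
+ multiplicativity, `sectionsEquiv_symm_pow`).  (Liu, §10.2.2, p. 499; [AbsTopIII] Rmk. 1.5.4 (i)
p. 33.) [cite: Liu2002, §10.2.2 (p. 499)] -/
theorem IsNeronModel.exists_section_of_forall_exists_pow_eq (h : IsNeronModel R K 𝒩 E)
    (x : specOver K K ⟶ E) (hx : ∀ n : ℕ, 0 < n → ∃ y : specOver K K ⟶ E, y ^ n = x) :
    ∃ s : 𝟙_ (Over (Spec (.of R))) ⟶ 𝒩, toUnit (specOver K K) ≫ h.sectionsEquiv s = x ∧
      ∀ n : ℕ, 0 < n → ∃ t : 𝟙_ (Over (Spec (.of R))) ⟶ 𝒩, t ^ n = s := by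
  obtain ⟨x', hx'⟩ := exists_eq_toUnit_comp E x
  refine ⟨h.sectionsEquiv.symm x', by rw [Equiv.apply_symm_apply, hx'], ?_⟩
  exact h.forall_exists_pow_eq_sectionsEquiv_symm x'
    (forall_exists_pow_eq_of_toUnit_comp E x' (by simpa only [hx'] using hx))

/-- Conversely, if that section is the unit section then the point is trivial: `s = 1` gives
`toUnit ≫ h.sectionsEquiv s = 1` in `E(K)` (junction J-c (iii); combine with
`Over.tensorUnit_hom_ext_of_forall_maximal_pullback` and `pullback_map_eq_of_forall_exists_pow_eq`).
[cite: Liu2002, §10.2.2 (p. 499)] -/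
theorem IsNeronModel.toUnit_comp_sectionsEquiv_eq_one (h : IsNeronModel R K 𝒩 E)
    {s : 𝟙_ (Over (Spec (.of R))) ⟶ 𝒩} (hs : s = 1) :
    toUnit (specOver K K) ≫ h.sectionsEquiv s = 1 :=
  toUnit_comp_eq_one E (by rw [hs, h.sectionsEquiv_one])

end Neron

end Literature.NumberTheory.EllipticCurves

end
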